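import Summits.AtomisticToContinuum.Crystallization.Theorems.ChessboardParticlePlanesPeriodicWindowsGapSqueezeCompetitor1
import Literature.MathematicalPhysics.StatisticalMechanics.LennardJonesClusters
import Summits.AtomisticToContinuum.Crystallization.Theorems.HullBridge.Negative.WindowsNeedMinimality

/-!
# Crux `PeriodicWindows` (stmt-AtomisticToContinuum-3240), line `dense-laminar-hull` — the compression competitor of the
# gap squeeze (`stub_gapSqueeze`, lead c11), part 2: separation, site-by-site comparison, uniform gain

For a `7/10`-separated general layered set `S = B '' {i • v₁(a) + j • v₂(a) + δ m + z m • e₃}` and its compression `S'`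
(heights `z'` with increments `min (z (m+1) - z m) 1`, part 1):

* `S'` is `7/10`-separated (`gsc_sep_compressed`);
* the site energy of every site of `S'` is at most that of the corresponding site of `S` (`gsc_site_le`; both site sums
  are absolutely convergent by `LayeredHull.wb_summable`, and the comparison is termwise, part 1);
* if the gaps of `z` are bounded, there is a fixed `c > 0` gained at every site lying directly below a gap `≥ 1 + η`
  (`gsc_site_gain`): the site of the next layer within horizontal distance `2a` (`gsc_cover`) moves from distance
  `√(H + g²)` to `√(H + 1)`, and `V(√(H + g²)) - V(√(H + 1)) ≥ c` uniformly on the compact parameter rectangle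
  (`gsc_gain_const`: continuity of `V_LJ` off `0` and strict monotonicity on `[1, ∞)`).

`gsc_competitor` bundles the three clauses (registered helper statement of the line). All elementary. [folklore]
-/

noncomputable section

namespace Summit.AtomisticToContinuum.Crystallization.Theorems.PeriodicWindowsDenseLaminarHull

open Literature.MathematicalPhysics.StatisticalMechanics Filter Metric
open scoped BigOperators


/-! ## The uniform gain under a wide gap -/

/-- **Uniform gain.** There is `c > 0` (depending on `a`, `η`, `G`) such that
`V(√(H + g²)) - V(√(H + 1)) ≥ c` for all `0 ≤ H ≤ (2a)²` and `1 + η ≤ g ≤ G`: the function is continuous and pointwise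
positive (`√(H+1) ≥ 1`, `V_LJ` strictly increasing on `[1, ∞)`) on a compact rectangle. [folklore] -/
theorem gsc_gain_const (a η G : ℝ) (hη : 0 < η) : ∃ c : ℝ, 0 < c ∧ ∀ H g : ℝ, 0 ≤ H → H ≤ (2 * a) ^ 2 →
    1 + η ≤ g → g ≤ G → c ≤ lennardJones (√(H + g ^ 2)) - lennardJones (√(H + 1)) := by
  have hKc : IsCompact (Set.Icc (0 : ℝ) ((2 * a) ^ 2) ×ˢ Set.Icc (1 + η) (max G (1 + η))) :=
    isCompact_Icc.prod isCompact_Icc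
  have hKne : (Set.Icc (0 : ℝ) ((2 * a) ^ 2) ×ˢ Set.Icc (1 + η) (max G (1 + η))).Nonempty :=
    ⟨(0, 1 + η), ⟨le_rfl, sq_nonneg _⟩, ⟨le_rfl, le_max_right _ _⟩⟩
  -- pointwise positivity
  have hpos : ∀ p ∈ Set.Icc (0 : ℝ) ((2 * a) ^ 2) ×ˢ Set.Icc (1 + η) (max G (1 + η)),
      0 < lennardJones (√(p.1 + p.2 ^ 2)) - lennardJones (√(p.1 + 1)) := by
    rintro ⟨H, g⟩ ⟨⟨hH0, -⟩, ⟨hg1, -⟩⟩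
    dsimp only
    have h1 : 1 ≤ √(H + 1) := by
      calc (1 : ℝ) = √1 := Real.sqrt_one.symm
        _ ≤ √(H + 1) := Real.sqrt_le_sqrt (by linarith)
    have h2 : √(H + 1) < √(H + g ^ 2) := by
      apply Real.sqrt_lt_sqrt (by linarith)
      nlinarith
    have := Literature.Barriers.AtomisticToContinuum.strictMonoOn_lennardJones (Set.mem_Ici.2 h1)
      (Set.mem_Ici.2 (h1.trans h2.le)) h2
    linarith
  -- continuity on the rectangle
  have hV : ContinuousOn lennardJones {0}ᶜ := continuousOn_lennardJones
  have hcont : ContinuousOn (fun p : ℝ × ℝ => lennardJones (√(p.1 + p.2 ^ 2)) - lennardJones (√(p.1 + 1)))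
      (Set.Icc (0 : ℝ) ((2 * a) ^ 2) ×ˢ Set.Icc (1 + η) (max G (1 + η))) := by
    have c1 : ContinuousOn (fun p : ℝ × ℝ => lennardJones (√(p.1 + p.2 ^ 2)))
        (Set.Icc (0 : ℝ) ((2 * a) ^ 2) ×ˢ Set.Icc (1 + η) (max G (1 + η))) := by
      refine hV.comp (s := Set.Icc (0 : ℝ) ((2 * a) ^ 2) ×ˢ Set.Icc (1 + η) (max G (1 + η)))
        (f := fun p : ℝ × ℝ => √(p.1 + p.2 ^ 2)) (Continuous.continuousOn (by fun_prop)) ?_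
      rintro ⟨H, g⟩ ⟨⟨hH0, -⟩, ⟨hg1, -⟩⟩
      simp only [Set.mem_compl_iff, Set.mem_singleton_iff]
      have : 0 < √(H + g ^ 2) := Real.sqrt_pos.2 (by nlinarith)
      exact this.ne'
    have c2 : ContinuousOn (fun p : ℝ × ℝ => lennardJones (√(p.1 + 1)))
        (Set.Icc (0 : ℝ) ((2 * a) ^ 2) ×ˢ Set.Icc (1 + η) (max G (1 + η))) := by
      refine hV.comp (s := Set.Icc (0 : ℝ) ((2 * a) ^ 2) ×ˢ Set.Icc (1 + η) (max G (1 + η)))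
        (f := fun p : ℝ × ℝ => √(p.1 + 1)) (Continuous.continuousOn (by fun_prop)) ?_
      rintro ⟨H, g⟩ ⟨⟨hH0, -⟩, -⟩
      simp only [Set.mem_compl_iff, Set.mem_singleton_iff]
      have : 0 < √(H + 1) := Real.sqrt_pos.2 (by linarith)
      exact this.ne'
    exact c1.sub c2
  obtain ⟨p₀, hp₀, hmin⟩ := hKc.exists_isMinOn hKne hcont
  rw [isMinOn_iff] at hmin
  refine ⟨_, hpos p₀ hp₀, fun H g hH0 hH hg1 hgG => ?_⟩
  exact hmin (H, g) ⟨⟨hH0, hH⟩, ⟨hg1, hgG.trans (le_max_left _ _)⟩⟩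

/-- `‖v₂(a)‖ = a` for `a ≥ 0`. [folklore] -/
theorem gsc_norm_triangularVec₂ {a : ℝ} (ha : 0 ≤ a) : ‖triangularVec₂ a‖ = a := by
  have h3 : (√3 : ℝ) ^ 2 = 3 := Real.sq_sqrt (by norm_num)
  have h : ‖triangularVec₂ a‖ ^ 2 = a ^ 2 := by
    rw [gsc_norm_sq_eq]
    simp only [triangularVec₂, PiLp.toLp_apply, Matrix.cons_val_zero, Matrix.cons_val_one, Matrix.cons_val]
    nlinarith [h3]
  nlinarith [norm_nonneg (triangularVec₂ a), sq_nonneg (‖triangularVec₂ a‖ - a), sq_nonneg (‖triangularVec₂ a‖ + a)]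

/-- **Covering by the layer lattice**: every horizontal vector is within `2a` of a point of `ℤ v₁(a) + ℤ v₂(a)`
(`a > 0`): write it as `α v₁ + β v₂` and round the coefficients down. [folklore] -/
theorem gsc_cover {a : ℝ} (ha : 0 < a) (w : EuclideanSpace ℝ (Fin 3)) (hw : w 2 = 0) :
    ∃ i j : ℤ, ‖w - ((i : ℝ) • triangularVec₁ a + (j : ℝ) • triangularVec₂ a)‖ ≤ 2 * a := by
  have hs3 : (0 : ℝ) < √3 := Real.sqrt_pos.2 (by norm_num)
  set β : ℝ := 2 * w 1 / (a * √3) with hβ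
  set α : ℝ := (w 0 - β * (a / 2)) / a with hα
  have hwrite : w = α • triangularVec₁ a + β • triangularVec₂ a := by
    ext k
    fin_cases k
    · simp only [Fin.zero_eta, Fin.isValue, PiLp.add_apply, PiLp.smul_apply, smul_eq_mul, triangularVec₁,
        triangularVec₂, Matrix.cons_val_zero]
      rw [hα]; field_simp; ring
    · simp only [Fin.mk_one, Fin.isValue, PiLp.add_apply, PiLp.smul_apply, smul_eq_mul, triangularVec₁,
        triangularVec₂, Matrix.cons_val_one, Matrix.cons_val_zero]
      rw [hβ]; field_simp; ring
    · simp only [Fin.reduceFinMk, Fin.isValue, PiLp.add_apply, PiLp.smul_apply, smul_eq_mul]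
      rw [hw, gsc_triangularVec₁_two, gsc_triangularVec₂_two]; ring
  refine ⟨⌊α⌋, ⌊β⌋, ?_⟩
  have e : w - ((⌊α⌋ : ℝ) • triangularVec₁ a + (⌊β⌋ : ℝ) • triangularVec₂ a) =
      Int.fract α • triangularVec₁ a + Int.fract β • triangularVec₂ a := by
    rw [hwrite, Int.fract, Int.fract]; module
  rw [e]
  calc ‖Int.fract α • triangularVec₁ a + Int.fract β • triangularVec₂ a‖
      ≤ ‖Int.fract α • triangularVec₁ a‖ + ‖Int.fract β • triangularVec₂ a‖ := norm_add_le _ _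
    _ = |Int.fract α| * a + |Int.fract β| * a := by
        rw [norm_smul, norm_smul, Real.norm_eq_abs, Real.norm_eq_abs, HullBridge.Negative.WindowsNeedMinimality.norm_triangularVec₁ ha.le,
          gsc_norm_triangularVec₂ ha.le]
    _ ≤ 1 * a + 1 * a := by
        gcongr
        · rw [abs_of_nonneg (Int.fract_nonneg α)]; exact (Int.fract_lt_one α).le
        · rw [abs_of_nonneg (Int.fract_nonneg β)]; exact (Int.fract_lt_one β).le
    _ = 2 * a := by ring

/-! ## The competitor: separation, site-by-site comparison, gain -/

/-- Same-layer distances do not depend on the heights. [folklore] -/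
theorem gsc_dist_sameLayer {a : ℝ} {B : EuclideanSpace ℝ (Fin 3) ≃ₗᵢ[ℝ] EuclideanSpace ℝ (Fin 3)}
    {δ : ℤ → EuclideanSpace ℝ (Fin 3)} (hδ : ∀ m : ℤ, (δ m) 2 = 0) (m : ℤ) (i j i' j' s s' : ℝ) :
    dist (B (i • triangularVec₁ a + j • triangularVec₂ a + δ m + s • layerNormal 1))
        (B (i' • triangularVec₁ a + j' • triangularVec₂ a + δ m + s • layerNormal 1)) =
      dist (B (i • triangularVec₁ a + j • triangularVec₂ a + δ m + s' • layerNormal 1))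
        (B (i' • triangularVec₁ a + j' • triangularVec₂ a + δ m + s' • layerNormal 1)) := by
  have e1 := gsc_dist_sq (a := a) (B := B) hδ m m i j i' j' s s
  have e2 := gsc_dist_sq (a := a) (B := B) hδ m m i j i' j' s' s'
  simp only [sub_self, ne_eq, OfNat.ofNat_ne_zero, not_false_eq_true, zero_pow, add_zero] at e1 e2
  rw [← e2] at e1
  exact (pow_left_inj₀ dist_nonneg dist_nonneg two_ne_zero).1 e1

/-- **(1) The compressed set is `7/10`-separated** if the original one is: same-layer distances are unchanged,
cross-layer distances are at least the compressed height difference `≥ 3/4`. [folklore] -/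
theorem gsc_sep_compressed {a : ℝ} (ha : 0 < a) {B : EuclideanSpace ℝ (Fin 3) ≃ₗᵢ[ℝ] EuclideanSpace ℝ (Fin 3)}
    {δ : ℤ → EuclideanSpace ℝ (Fin 3)} {z z' : ℤ → ℝ} (hB : ∀ p : EuclideanSpace ℝ (Fin 3), (B p) 2 = p 2)
    (hδ : ∀ m : ℤ, (δ m) 2 = 0) (hz : StrictMono z) (hgap : ∀ m : ℤ, (3 : ℝ) / 4 ≤ z (m + 1) - z m)
    (hz' : ∀ m : ℤ, z' (m + 1) - z' m = min (z (m + 1) - z m) 1) {S S' : Set (EuclideanSpace ℝ (Fin 3))}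
    (hS : S = (fun p => B p) '' {p | ∃ m i j : ℤ, p = ((i : ℝ) • triangularVec₁ a) +
      ((j : ℝ) • triangularVec₂ a) + δ m + (z m • layerNormal 1)})
    (hS' : S' = (fun p => B p) '' {p | ∃ m i j : ℤ, p = ((i : ℝ) • triangularVec₁ a) +
      ((j : ℝ) • triangularVec₂ a) + δ m + (z' m • layerNormal 1)})
    (hsep : ∀ p ∈ S, ∀ q ∈ S, p ≠ q → (7 : ℝ) / 10 ≤ dist p q) :
    ∀ p ∈ S', ∀ q ∈ S', p ≠ q → (7 : ℝ) / 10 ≤ dist p q := by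
  have hz'mono : StrictMono z' := gsc_sq_strictMono z z' hgap hz'
  have hinj := gsc_param_injective (a := a) ha hB hδ hz.injective
  have hrange' := gsc_range_param (a := a) B δ z'
  rw [← hS'] at hrange'
  intro p hp q hq hpq
  rw [← hrange'] at hp hq
  obtain ⟨⟨m, i, j⟩, rfl⟩ := hp
  obtain ⟨⟨m', i', j'⟩, rfl⟩ := hq
  dsimp only at hpq ⊢
  by_cases hm : m = m'
  · subst hm
    rw [gsc_dist_sameLayer hδ m _ _ _ _ (z' m) (z m)]
    refine hsep _ ?_ _ ?_ fun h => hpq ?_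
    · rw [hS]; exact ⟨_, ⟨m, i, j, rfl⟩, rfl⟩
    · rw [hS]; exact ⟨_, ⟨m, i', j', rfl⟩, rfl⟩
    · have := @hinj (m, i, j) (m, i', j') h
      simp only [Prod.mk.injEq, true_and] at this
      rw [this.1, this.2]
  · have e1 := gsc_dist_sq (a := a) (B := B) hδ m m' (i : ℝ) j i' j' (z' m) (z' m')
    obtain ⟨-, -, h34⟩ := gsc_sq_abs z z' hgap hz' m m'
    have h34 := h34 hm
    have hsq : ((3 : ℝ) / 4) ^ 2 ≤ (z' m - z' m') ^ 2 := by
      rw [← sq_abs (z' m - z' m')]; exact pow_le_pow_left₀ (by norm_num) h34 2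
    have hd : ((3 : ℝ) / 4) ^ 2 ≤ dist (B (((i : ℝ)) • triangularVec₁ a + ((j : ℝ)) • triangularVec₂ a + δ m +
        z' m • layerNormal 1)) (B (((i' : ℝ)) • triangularVec₁ a + ((j' : ℝ)) • triangularVec₂ a + δ m' +
        z' m' • layerNormal 1)) ^ 2 := by
      rw [e1]
      nlinarith [norm_nonneg (((i : ℝ) - i') • triangularVec₁ a + ((j : ℝ) - j') • triangularVec₂ a +
        (δ m - δ m'))]
    have h34' := (pow_le_pow_iff_left₀ (by norm_num) dist_nonneg two_ne_zero).1 hd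
    linarith

/-- Re-indexing of the punctured site sum of a layered set by `ℤ³ ∖ {(m, i, j)}` (special case of `gsc_reindex`
for the standard parametrisation, stated with the site written out). [folklore] -/
theorem gsc_reindex_site {a : ℝ} (ha : 0 < a) {B : EuclideanSpace ℝ (Fin 3) ≃ₗᵢ[ℝ] EuclideanSpace ℝ (Fin 3)}
    {δ : ℤ → EuclideanSpace ℝ (Fin 3)} {z : ℤ → ℝ} (hB : ∀ p : EuclideanSpace ℝ (Fin 3), (B p) 2 = p 2)
    (hδ : ∀ m : ℤ, (δ m) 2 = 0) (hz : Function.Injective z) {S : Set (EuclideanSpace ℝ (Fin 3))}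
    (hS : S = (fun p => B p) '' {p | ∃ m i j : ℤ, p = ((i : ℝ) • triangularVec₁ a) +
      ((j : ℝ) • triangularVec₂ a) + δ m + (z m • layerNormal 1)}) (m i j : ℤ)
    (f : EuclideanSpace ℝ (Fin 3) → ℝ) :
    (∑' q : {q : EuclideanSpace ℝ (Fin 3) // q ∈ S ∧ q ≠ B (((i : ℝ) • triangularVec₁ a) +
        ((j : ℝ) • triangularVec₂ a) + δ m + (z m • layerNormal 1))}, f q) =
      ∑' t : {t : ℤ × ℤ × ℤ // t ≠ (m, i, j)}, f (B (((t.1.2.1 : ℝ)) • triangularVec₁ a +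
        ((t.1.2.2 : ℝ)) • triangularVec₂ a + δ t.1.1 + z t.1.1 • layerNormal 1)) ∧
    ((Summable fun q : {q : EuclideanSpace ℝ (Fin 3) // q ∈ S ∧ q ≠ B (((i : ℝ) • triangularVec₁ a) +
        ((j : ℝ) • triangularVec₂ a) + δ m + (z m • layerNormal 1))} => f q) ↔
      Summable fun t : {t : ℤ × ℤ × ℤ // t ≠ (m, i, j)} => f (B (((t.1.2.1 : ℝ)) • triangularVec₁ a +
        ((t.1.2.2 : ℝ)) • triangularVec₂ a + δ t.1.1 + z t.1.1 • layerNormal 1))) := by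
  have hrange := gsc_range_param (a := a) B δ z
  rw [← hS] at hrange
  exact gsc_reindex (gsc_param_injective (a := a) ha hB hδ hz) hrange (m, i, j) f

/-- **(2) Site-by-site comparison**: the site energy of a site of the compressed set `S'` is at most the site energy
of the corresponding site of `S`. [folklore] -/
theorem gsc_site_le {a : ℝ} (ha : 0 < a) {B : EuclideanSpace ℝ (Fin 3) ≃ₗᵢ[ℝ] EuclideanSpace ℝ (Fin 3)}
    {δ : ℤ → EuclideanSpace ℝ (Fin 3)} {z z' : ℤ → ℝ} (hB : ∀ p : EuclideanSpace ℝ (Fin 3), (B p) 2 = p 2)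
    (hδ : ∀ m : ℤ, (δ m) 2 = 0) (hz : StrictMono z) (hgap : ∀ m : ℤ, (3 : ℝ) / 4 ≤ z (m + 1) - z m)
    (hz' : ∀ m : ℤ, z' (m + 1) - z' m = min (z (m + 1) - z m) 1) {S S' : Set (EuclideanSpace ℝ (Fin 3))}
    (hS : S = (fun p => B p) '' {p | ∃ m i j : ℤ, p = ((i : ℝ) • triangularVec₁ a) +
      ((j : ℝ) • triangularVec₂ a) + δ m + (z m • layerNormal 1)})
    (hS' : S' = (fun p => B p) '' {p | ∃ m i j : ℤ, p = ((i : ℝ) • triangularVec₁ a) +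
      ((j : ℝ) • triangularVec₂ a) + δ m + (z' m • layerNormal 1)})
    (hsep : ∀ p ∈ S, ∀ q ∈ S, p ≠ q → (7 : ℝ) / 10 ≤ dist p q) (m i j : ℤ) :
    (∑' q : {q : EuclideanSpace ℝ (Fin 3) // q ∈ S' ∧ q ≠ B (((i : ℝ) • triangularVec₁ a) +
        ((j : ℝ) • triangularVec₂ a) + δ m + (z' m • layerNormal 1))},
      lennardJones (dist (B (((i : ℝ) • triangularVec₁ a) + ((j : ℝ) • triangularVec₂ a) + δ m +
        (z' m • layerNormal 1))) (q : EuclideanSpace ℝ (Fin 3)))) ≤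
    ∑' q : {q : EuclideanSpace ℝ (Fin 3) // q ∈ S ∧ q ≠ B (((i : ℝ) • triangularVec₁ a) +
        ((j : ℝ) • triangularVec₂ a) + δ m + (z m • layerNormal 1))},
      lennardJones (dist (B (((i : ℝ) • triangularVec₁ a) + ((j : ℝ) • triangularVec₂ a) + δ m +
        (z m • layerNormal 1))) (q : EuclideanSpace ℝ (Fin 3))) := by
  have hz'mono : StrictMono z' := gsc_sq_strictMono z z' hgap hz'
  have hsep' := gsc_sep_compressed ha hB hδ hz hgap hz' hS hS' hsep
  obtain ⟨e, hsum⟩ := gsc_reindex_site ha hB hδ hz.injective hS m i j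
    (fun q => lennardJones (dist (B (((i : ℝ) • triangularVec₁ a) + ((j : ℝ) • triangularVec₂ a) + δ m +
        (z m • layerNormal 1))) q))
  obtain ⟨e', hsum'⟩ := gsc_reindex_site ha hB hδ hz'mono.injective hS' m i j
    (fun q => lennardJones (dist (B (((i : ℝ) • triangularVec₁ a) + ((j : ℝ) • triangularVec₂ a) + δ m +
        (z' m • layerNormal 1))) q))
  have hmem : B (((i : ℝ) • triangularVec₁ a) + ((j : ℝ) • triangularVec₂ a) + δ m + (z m • layerNormal 1)) ∈ S := by
    rw [hS]; exact ⟨_, ⟨m, i, j, rfl⟩, rfl⟩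
  have hmem' : B (((i : ℝ) • triangularVec₁ a) + ((j : ℝ) • triangularVec₂ a) + δ m + (z' m • layerNormal 1)) ∈ S' := by
    rw [hS']; exact ⟨_, ⟨m, i, j, rfl⟩, rfl⟩
  have hS1 := hsum.1 (LayeredHull.wb_summable (by norm_num : (0 : ℝ) < 7 / 10) hsep hmem)
  have hS2 := hsum'.1 (LayeredHull.wb_summable (by norm_num : (0 : ℝ) < 7 / 10) hsep' hmem')
  rw [e, e']
  refine Summable.tsum_le_tsum (fun t => ?_) hS2 hS1
  exact gsc_term_le (B := B) hδ hgap hz' m t.1.1 (i : ℝ) j t.1.2.1 t.1.2.2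

/-- **(3) The gain under a wide gap**: if the gaps of `z` are bounded by `G`, there is `c > 0` such that at every site
lying directly below a gap `≥ 1 + η` the site energy of the compressed set is smaller by at least `c`. [folklore] -/
theorem gsc_site_gain {a η G : ℝ} (ha : 0 < a) (hη : 0 < η)
    {B : EuclideanSpace ℝ (Fin 3) ≃ₗᵢ[ℝ] EuclideanSpace ℝ (Fin 3)}
    {δ : ℤ → EuclideanSpace ℝ (Fin 3)} {z z' : ℤ → ℝ} (hB : ∀ p : EuclideanSpace ℝ (Fin 3), (B p) 2 = p 2)
    (hδ : ∀ m : ℤ, (δ m) 2 = 0) (hz : StrictMono z) (hgap : ∀ m : ℤ, (3 : ℝ) / 4 ≤ z (m + 1) - z m)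
    (hgapG : ∀ m : ℤ, z (m + 1) - z m ≤ G)
    (hz' : ∀ m : ℤ, z' (m + 1) - z' m = min (z (m + 1) - z m) 1) {S S' : Set (EuclideanSpace ℝ (Fin 3))}
    (hS : S = (fun p => B p) '' {p | ∃ m i j : ℤ, p = ((i : ℝ) • triangularVec₁ a) +
      ((j : ℝ) • triangularVec₂ a) + δ m + (z m • layerNormal 1)})
    (hS' : S' = (fun p => B p) '' {p | ∃ m i j : ℤ, p = ((i : ℝ) • triangularVec₁ a) +
      ((j : ℝ) • triangularVec₂ a) + δ m + (z' m • layerNormal 1)})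
    (hsep : ∀ p ∈ S, ∀ q ∈ S, p ≠ q → (7 : ℝ) / 10 ≤ dist p q) :
    ∃ c : ℝ, 0 < c ∧ ∀ m i j : ℤ, 1 + η ≤ z (m + 1) - z m →
      (∑' q : {q : EuclideanSpace ℝ (Fin 3) // q ∈ S' ∧ q ≠ B (((i : ℝ) • triangularVec₁ a) +
          ((j : ℝ) • triangularVec₂ a) + δ m + (z' m • layerNormal 1))},
        lennardJones (dist (B (((i : ℝ) • triangularVec₁ a) + ((j : ℝ) • triangularVec₂ a) + δ m +
          (z' m • layerNormal 1))) (q : EuclideanSpace ℝ (Fin 3)))) + c ≤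
      ∑' q : {q : EuclideanSpace ℝ (Fin 3) // q ∈ S ∧ q ≠ B (((i : ℝ) • triangularVec₁ a) +
          ((j : ℝ) • triangularVec₂ a) + δ m + (z m • layerNormal 1))},
        lennardJones (dist (B (((i : ℝ) • triangularVec₁ a) + ((j : ℝ) • triangularVec₂ a) + δ m +
          (z m • layerNormal 1))) (q : EuclideanSpace ℝ (Fin 3))) := by
  obtain ⟨c, hc, hcb⟩ := gsc_gain_const a η G hη
  refine ⟨c, hc, fun m i j hwide => ?_⟩
  have hz'mono : StrictMono z' := gsc_sq_strictMono z z' hgap hz'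
  have hsep' := gsc_sep_compressed ha hB hδ hz hgap hz' hS hS' hsep
  obtain ⟨e, hsum⟩ := gsc_reindex_site ha hB hδ hz.injective hS m i j
    (fun q => lennardJones (dist (B (((i : ℝ) • triangularVec₁ a) + ((j : ℝ) • triangularVec₂ a) + δ m +
        (z m • layerNormal 1))) q))
  obtain ⟨e', hsum'⟩ := gsc_reindex_site ha hB hδ hz'mono.injective hS' m i j
    (fun q => lennardJones (dist (B (((i : ℝ) • triangularVec₁ a) + ((j : ℝ) • triangularVec₂ a) + δ m +
        (z' m • layerNormal 1))) q))
  have hmem : B (((i : ℝ) • triangularVec₁ a) + ((j : ℝ) • triangularVec₂ a) + δ m + (z m • layerNormal 1)) ∈ S := by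
    rw [hS]; exact ⟨_, ⟨m, i, j, rfl⟩, rfl⟩
  have hmem' : B (((i : ℝ) • triangularVec₁ a) + ((j : ℝ) • triangularVec₂ a) + δ m + (z' m • layerNormal 1)) ∈ S' := by
    rw [hS']; exact ⟨_, ⟨m, i, j, rfl⟩, rfl⟩
  have hS1 := hsum.1 (LayeredHull.wb_summable (by norm_num : (0 : ℝ) < 7 / 10) hsep hmem)
  have hS2 := hsum'.1 (LayeredHull.wb_summable (by norm_num : (0 : ℝ) < 7 / 10) hsep' hmem')
  rw [e, e']
  -- the site straight above, within horizontal distance `2a`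
  obtain ⟨i₁, j₁, hcov⟩ := gsc_cover ha ((i : ℝ) • triangularVec₁ a + (j : ℝ) • triangularVec₂ a +
    (δ m - δ (m + 1))) (gsc_horiz_two hδ m (m + 1) _ _)
  have hne : ((m + 1, i₁, j₁) : ℤ × ℤ × ℤ) ≠ (m, i, j) := by
    simp only [ne_eq, Prod.mk.injEq, add_eq_left, one_ne_zero, false_and, not_false_eq_true]
  -- the difference of the two sums is the sum of the (nonnegative) differences, at least the term above
  have hdiff := hS1.tsum_sub hS2
  have hterm := (hS1.sub hS2).le_tsum ⟨(m + 1, i₁, j₁), hne⟩ (fun t _ => sub_nonneg.2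
    (gsc_term_le (B := B) hδ hgap hz' m t.1.1 (i : ℝ) j t.1.2.1 t.1.2.2))
  rw [hdiff] at hterm
  -- evaluate the term above: distances `√(H + g²)` and `√(H + 1)`
  have hH : ‖((i : ℝ) - (i₁ : ℝ)) • triangularVec₁ a + ((j : ℝ) - (j₁ : ℝ)) • triangularVec₂ a +
      (δ m - δ (m + 1))‖ ≤ 2 * a := by
    have : ((i : ℝ) - (i₁ : ℝ)) • triangularVec₁ a + ((j : ℝ) - (j₁ : ℝ)) • triangularVec₂ a + (δ m - δ (m + 1)) =
        (i : ℝ) • triangularVec₁ a + (j : ℝ) • triangularVec₂ a + (δ m - δ (m + 1)) -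
        ((i₁ : ℝ) • triangularVec₁ a + (j₁ : ℝ) • triangularVec₂ a) := by module
    rw [this]; exact hcov
  set H : ℝ := ‖((i : ℝ) - (i₁ : ℝ)) • triangularVec₁ a + ((j : ℝ) - (j₁ : ℝ)) • triangularVec₂ a +
      (δ m - δ (m + 1))‖ ^ 2 with hHdef
  have hH0 : 0 ≤ H := by positivity
  have hH4 : H ≤ (2 * a) ^ 2 := pow_le_pow_left₀ (norm_nonneg _) hH 2
  have hg1 : z' (m + 1) - z' m = 1 := by
    rw [hz' m]; exact min_eq_right (by linarith)
  have ed : dist (B (((i : ℝ)) • triangularVec₁ a + ((j : ℝ)) • triangularVec₂ a + δ m + z m • layerNormal 1))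
      (B (((i₁ : ℝ)) • triangularVec₁ a + ((j₁ : ℝ)) • triangularVec₂ a + δ (m + 1) + z (m + 1) • layerNormal 1)) =
      √(H + (z (m + 1) - z m) ^ 2) := by
    have e2 := gsc_dist_sq (a := a) (B := B) hδ m (m + 1) (i : ℝ) j i₁ j₁ (z m) (z (m + 1))
    rw [← Real.sqrt_sq dist_nonneg, e2, ← hHdef]
    congr 1; ring
  have ed' : dist (B (((i : ℝ)) • triangularVec₁ a + ((j : ℝ)) • triangularVec₂ a + δ m + z' m • layerNormal 1))
      (B (((i₁ : ℝ)) • triangularVec₁ a + ((j₁ : ℝ)) • triangularVec₂ a + δ (m + 1) + z' (m + 1) • layerNormal 1)) =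
      √(H + 1) := by
    have e2 := gsc_dist_sq (a := a) (B := B) hδ m (m + 1) (i : ℝ) j i₁ j₁ (z' m) (z' (m + 1))
    rw [← Real.sqrt_sq dist_nonneg, e2, ← hHdef]
    congr 1
    nlinarith [hg1]
  have hgain := hcb H (z (m + 1) - z m) hH0 hH4 hwide (hgapG m)
  rw [← ed, ← ed'] at hgain
  simp only at hterm
  linarith

/-! ## Summary of part 2 (registered helper statement) -/

/-- **The compression competitor of the gap squeeze (summary of the three clauses).** Let
`S = B '' {i v₁(a) + j v₂(a) + δ m + z m e₃}` be a `7/10`-separated general layered set (`B` a linear isometry preserving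
the third coordinate, horizontal offsets `δ`, strictly increasing heights `z` with gaps in `[3/4, G]`) and `S'` its
compression (heights `z'` with increments `min (z (m+1) - z m) 1`). Then `S'` is `7/10`-separated, every site energy of
`S'` is at most the corresponding site energy of `S`, and there is `c > 0` such that below every gap `≥ 1 + η` the site
energy drops by at least `c`. [folklore] -/
theorem gsc_competitor : ∀ a η G : ℝ, 0 < a → 0 < η →
    ∀ (B : EuclideanSpace ℝ (Fin 3) ≃ₗᵢ[ℝ] EuclideanSpace ℝ (Fin 3)) (δ : ℤ → EuclideanSpace ℝ (Fin 3)) (z z' : ℤ → ℝ),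
    (∀ p : EuclideanSpace ℝ (Fin 3), (B p) 2 = p 2) → (∀ m : ℤ, (δ m) 2 = 0) → StrictMono z →
    (∀ m : ℤ, (3 : ℝ) / 4 ≤ z (m + 1) - z m) → (∀ m : ℤ, z (m + 1) - z m ≤ G) →
    (∀ m : ℤ, z' (m + 1) - z' m = min (z (m + 1) - z m) 1) →
    ∀ S S' : Set (EuclideanSpace ℝ (Fin 3)),
    S = (fun p => B p) '' {p | ∃ m i j : ℤ, p = ((i : ℝ) • triangularVec₁ a) +
      ((j : ℝ) • triangularVec₂ a) + δ m + (z m • layerNormal 1)} →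
    S' = (fun p => B p) '' {p | ∃ m i j : ℤ, p = ((i : ℝ) • triangularVec₁ a) +
      ((j : ℝ) • triangularVec₂ a) + δ m + (z' m • layerNormal 1)} →
    (∀ p ∈ S, ∀ q ∈ S, p ≠ q → (7 : ℝ) / 10 ≤ dist p q) →
    (∀ p ∈ S', ∀ q ∈ S', p ≠ q → (7 : ℝ) / 10 ≤ dist p q) ∧
    (∀ m i j : ℤ,
      (∑' q : {q : EuclideanSpace ℝ (Fin 3) // q ∈ S' ∧ q ≠ B (((i : ℝ) • triangularVec₁ a) +
          ((j : ℝ) • triangularVec₂ a) + δ m + (z' m • layerNormal 1))},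
        lennardJones (dist (B (((i : ℝ) • triangularVec₁ a) + ((j : ℝ) • triangularVec₂ a) + δ m +
          (z' m • layerNormal 1))) (q : EuclideanSpace ℝ (Fin 3)))) ≤
      ∑' q : {q : EuclideanSpace ℝ (Fin 3) // q ∈ S ∧ q ≠ B (((i : ℝ) • triangularVec₁ a) +
          ((j : ℝ) • triangularVec₂ a) + δ m + (z m • layerNormal 1))},
        lennardJones (dist (B (((i : ℝ) • triangularVec₁ a) + ((j : ℝ) • triangularVec₂ a) + δ m +
          (z m • layerNormal 1))) (q : EuclideanSpace ℝ (Fin 3)))) ∧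
    (∃ c : ℝ, 0 < c ∧ ∀ m i j : ℤ, 1 + η ≤ z (m + 1) - z m →
      (∑' q : {q : EuclideanSpace ℝ (Fin 3) // q ∈ S' ∧ q ≠ B (((i : ℝ) • triangularVec₁ a) +
          ((j : ℝ) • triangularVec₂ a) + δ m + (z' m • layerNormal 1))},
        lennardJones (dist (B (((i : ℝ) • triangularVec₁ a) + ((j : ℝ) • triangularVec₂ a) + δ m +
          (z' m • layerNormal 1))) (q : EuclideanSpace ℝ (Fin 3)))) + c ≤
      ∑' q : {q : EuclideanSpace ℝ (Fin 3) // q ∈ S ∧ q ≠ B (((i : ℝ) • triangularVec₁ a) +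
          ((j : ℝ) • triangularVec₂ a) + δ m + (z m • layerNormal 1))},
        lennardJones (dist (B (((i : ℝ) • triangularVec₁ a) + ((j : ℝ) • triangularVec₂ a) + δ m +
          (z m • layerNormal 1))) (q : EuclideanSpace ℝ (Fin 3)))) := by
  intro a η G ha hη B δ z z' hB hδ hz hgap hgapG hz' S S' hS hS' hsep
  exact ⟨gsc_sep_compressed ha hB hδ hz hgap hz' hS hS' hsep,
    fun m i j => gsc_site_le ha hB hδ hz hgap hz' hS hS' hsep m i j,
    gsc_site_gain ha hη hB hδ hz hgap hgapG hz' hS hS' hsep⟩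


end Summit.AtomisticToContinuum.Crystallization.Theorems.PeriodicWindowsDenseLaminarHull

end
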